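import Mathlib
import Literature.NumberTheory.LFunctions.Zhang2022.Section7Eq75Majorants
import Literature.NumberTheory.LFunctions.Zhang2022.Section3Lemma33
import HarnessLib

/-!
# Zhang (2022) §7, (7.5): the two large-sieve factors of the Cauchy chain and the exponent count
# `(P²𝓛²²⁵)^{1/2}(P²𝓛³⁶)^{1/4}(𝔓𝓛⁻⁷³⁹)^{1/4} = o(𝔓)`

Topic `Literature/NumberTheory/LFunctions/Zhang2022` (Landau–Siegel adjudication tree;
verdict-neutral). Y. Zhang, *Discrete mean estimates and the Landau–Siegel zero*,
arXiv:2211.02515v1 (2022) [Zhang2022LandauSiegel] — **an unrefereed manuscript under adjudication**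
— §7, (7.5) (PDF p. 35, tex L1900–L1910): "The left side above is, by Cauchy's inequality,
`≤ (Σ_Ψ|Σ_{m<P²}(κ∗a₁)(m)ψ(m)m^{−s}|²)^{1/2}(Σ_Ψ|A(𝐚₂;1−s,ψ̄)|⁴)^{1/4}(Σ_{Ψ₂}1)^{1/4}
≪ (P²Σ_{m<P²}τ₅(m)²/m)^{1/2}(P²Σ_{m<P²}τ₂(m)²/m)^{1/4}(Σ_{Ψ₂}1)^{1/4}`. This yields (7.5) by
Proposition 2.1 and (2.9)."

D-0069 campaign (cell `siegel-zhang`), discharge of `Z22:§7.u019` / `Z22:(7.5)`, second file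
(sequel of `Section7Eq75Majorants`; 0 new facts). PROVED here:

* `finsum_norm_sq_dirPoly_le` — factor (i): for coefficients `|c(m)| ≤ Kτ_j(m)` and `σ = 1/2`,
  `Σ_{ψ∈Ψ}|Σ_{1≤m<P²}c(m)ψ(m)m^{−s}|² ≤ C₀⁺K²·P²Σ_{m<P²}τ_j(m)²/m`, from Lemma 3.3 (ii) of the
  manuscript — a THEOREM of the tree, `Skeleton.lemma33b_holds` (large sieve for primitive
  characters), consumed as the hypothesis `h33` with its constant `C₀` explicit;
* `finsum_norm_dirPolyBar_pow_four_le` — the fourth moment `Σ_{ψ∈Ψ}|Σ_{n<N}a(n)ψ̄(n)n^{−w}|⁴ ≤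
  C₀⁺B⁺⁴·P²Σ_{m<P²}τ₂(m)²/m` for ANY length `N` with `(N−1)² < P²`, `|a| ≤ B`, `Re w = 1/2` (square
  the polynomial — `sq_dirPoly_eq` — pass from `ψ̄` to `ψ` by complex conjugation, apply the large
  sieve, and `|a′⋆a′| ≤ B²τ₂`; reusable by the twin step (14.3), `N ≈ 2P₄`), and its instance
  `finsum_norm_ApolyBar_pow_four_le` — factor (ii) at the length `⌈PT⁻²⌉` of (7.2), `D ≥ 2`;
* `sum_tau_sq_div_Ico_le` — the printed counts `Σ_{m<P²}τ_j(m)²/m ≤ M_j(2𝓛⁹)^{j²}`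
  (`log P² = 2𝓛⁹`; tree `MeanSquareMajorant.sum_tau_sq_div_le`);
* `le_eps_mul_of_bounds` — the exponent count on opaque reals: the three factors, `#Ψ₂ ≤ C₂₁𝔓𝓛⁻⁷³⁹`
  (Prop. 2.1) and `|𝔓 − P²𝓛⁻⁷⁷| ≤ 3𝓛⁻⁶⁸P²𝓛⁻⁷⁷` ((2.9)) give `≤ ε𝔓` once
  `𝓛 ≥ max(6, 8K₁/ε⁴)`, `K₁ = |C|⁴M₅²M₂|C₂₁|2⁵⁴` (fourth powers: `𝓛^{450+36−739}` against `𝓛⁻²³¹`).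

WHAT THIS FILE IS NOT: any claim about the manuscript's Theorems 1–2 or about Landau–Siegel zeros.

## References

* Y. Zhang, arXiv:2211.02515v1 (2022), §7 (7.5) p. 35; §3 Lemma 3.3 p. 14; §2 (2.9) p. 5.
  [cite: Zhang2022LandauSiegel, §7 (7.5) p.35]
-/

noncomputable section

open Complex Real ComplexConjugate

namespace Literature.NumberTheory.LFunctions.Zhang2022.Section7Eq75

open Finset MeanSquareMajorant ArithmeticFunction

/-! ### The two factors

Both factor bounds consume Lemma 3.3 (ii) of the manuscript in the shape of the skeleton node
`Skeleton.Lemma33b` with its constant `C₀` made explicit (hypothesis `h33`); the node is a THEOREM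
of the tree (`Skeleton.lemma33b_holds`, `Section3Lemma33`), supplied in `Section7Eq75Discharge`. -/

section Factors

variable {D : ℕ}

/-- **Factor (i) of the Cauchy chain**, squared: for coefficients `|c(m)| ≤ Kτ_j(m)` (`m ≥ 1`)
and `σ = 1/2`, `Σ_{ψ∈Ψ}|Σ_{1≤m<P²}c(m)ψ(m)m^{−s}|² ≤ C₀⁺K²·P²Σ_{1≤m<P²}τ_j(m)²/m`
(large sieve on `c·1_{m<P²}`; in the manuscript `c = κ∗a₁`, `j = 5`).
[cite: Zhang2022LandauSiegel, §7 p.35, tex L1904–L1907] -/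
theorem finsum_norm_sq_dirPoly_le {C₀ : ℝ}
    (h33 : ∀ (D : ℕ) (s : ℂ) (c : ℕ → ℂ),
      ∑ᶠ x : Skeleton.Chr D, ‖∑ n ∈ Finset.Icc 1 ⌊Skeleton.bigP D ^ 2⌋₊,
          c n * x.ψ (n : ZMod x.p) * (n : ℂ) ^ (-s)‖ ^ 2 ≤
        C₀ * Skeleton.bigP D ^ 2 *
          ∑ n ∈ Finset.Icc 1 ⌊Skeleton.bigP D ^ 2⌋₊, ‖c n‖ ^ 2 * (n : ℝ) ^ (-2 * s.re))
    {K : ℝ} {j : ℕ}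
    {c : ℕ → ℂ} (hc : ∀ m, m ≠ 0 → ‖c m‖ ≤ K * tau j m) {s : ℂ} (hs : s.re = 1 / 2) :
    ∑ᶠ x : Skeleton.Chr D, ‖∑ m ∈ Finset.Ico 1 ⌈Skeleton.bigP D ^ 2⌉₊,
        c m * x.ψ (m : ZMod x.p) / (m : ℂ) ^ s‖ ^ 2 ≤
      max C₀ 0 * K ^ 2 * (Skeleton.bigP D ^ 2 *
        ∑ m ∈ Finset.Ico 1 ⌈Skeleton.bigP D ^ 2⌉₊, tau j m ^ 2 / (m : ℝ)) := by
  classical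
  set P := Skeleton.bigP D with hPdef
  set c₁ : ℕ → ℂ := fun n => if (n : ℝ) < P ^ 2 then c n else 0 with hc₁
  have hsub := Ico_subset_Icc_floor (P ^ 2)
  have hinner : ∀ x : Skeleton.Chr D,
      ∑ n ∈ Finset.Icc 1 ⌊P ^ 2⌋₊, c₁ n * x.ψ (n : ZMod x.p) * (n : ℂ) ^ (-s) =
        ∑ m ∈ Finset.Ico 1 ⌈P ^ 2⌉₊, c m * x.ψ (m : ZMod x.p) / (m : ℂ) ^ s := by
    intro x
    symm
    refine (Finset.sum_congr rfl fun m hm => ?_).trans (Finset.sum_subset hsub fun m hm hm' => ?_)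
    · have hm1 : (m : ℝ) < P ^ 2 := Nat.lt_ceil.1 (Finset.mem_Ico.1 hm).2
      simp only [hc₁, hm1, ↓reduceIte]
      rw [div_eq_mul_inv, Complex.cpow_neg]
    · simp only [hc₁, if_neg (not_lt_of_mem_sdiff hm hm'), zero_mul]
  have h := h33 D s c₁
  rw [← hPdef] at h
  simp only [hinner] at h
  have hcoef : ∑ n ∈ Finset.Icc 1 ⌊P ^ 2⌋₊, ‖c₁ n‖ ^ 2 * (n : ℝ) ^ (-2 * s.re) ≤
      K ^ 2 * ∑ m ∈ Finset.Ico 1 ⌈P ^ 2⌉₊, tau j m ^ 2 / (m : ℝ) := by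
    rw [hs, show (-2 * (1 / 2 : ℝ)) = -1 by norm_num]
    rw [← Finset.sum_subset hsub (fun m hm hm' => by
      simp only [hc₁, if_neg (not_lt_of_mem_sdiff hm hm'), norm_zero]; simp), Finset.mul_sum]
    refine Finset.sum_le_sum fun m hm => ?_
    have hm0 : m ≠ 0 := Nat.one_le_iff_ne_zero.1 (Finset.mem_Ico.1 hm).1
    have hm1 : (m : ℝ) < P ^ 2 := Nat.lt_ceil.1 (Finset.mem_Ico.1 hm).2
    simp only [hc₁, hm1, ↓reduceIte, Real.rpow_neg_one]
    have hk2 := pow_le_pow_left₀ (norm_nonneg _) (hc m hm0) 2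
    calc ‖c m‖ ^ 2 * (m : ℝ)⁻¹ ≤ (K * tau j m) ^ 2 * (m : ℝ)⁻¹ :=
          mul_le_mul_of_nonneg_right hk2 (by positivity)
      _ = K ^ 2 * (tau j m ^ 2 / m) := by ring
  have hS : 0 ≤ ∑ n ∈ Finset.Icc 1 ⌊P ^ 2⌋₊, ‖c₁ n‖ ^ 2 * (n : ℝ) ^ (-2 * s.re) :=
    Finset.sum_nonneg fun n _ => by positivity
  calc ∑ᶠ x : Skeleton.Chr D, ‖∑ m ∈ Finset.Ico 1 ⌈P ^ 2⌉₊, c m * x.ψ (m : ZMod x.p) / (m : ℂ) ^ s‖ ^ 2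
      ≤ C₀ * P ^ 2 * ∑ n ∈ Finset.Icc 1 ⌊P ^ 2⌋₊, ‖c₁ n‖ ^ 2 * (n : ℝ) ^ (-2 * s.re) := h
    _ ≤ max C₀ 0 * P ^ 2 * ∑ n ∈ Finset.Icc 1 ⌊P ^ 2⌋₊, ‖c₁ n‖ ^ 2 * (n : ℝ) ^ (-2 * s.re) :=
        mul_le_mul_of_nonneg_right (mul_le_mul_of_nonneg_right (le_max_left _ _) (sq_nonneg _)) hS
    _ ≤ max C₀ 0 * P ^ 2 * (K ^ 2 * ∑ m ∈ Finset.Ico 1 ⌈P ^ 2⌉₊, tau j m ^ 2 / (m : ℝ)) :=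
        mul_le_mul_of_nonneg_left hcoef (by positivity)
    _ = _ := by ring

/-- **The fourth moment of a truncated Dirichlet polynomial in `ψ̄`** (generic form of factor (ii)):
for `|a| ≤ B`, `Re w = 1/2` and a length `N` with `(N−1)² < P²`,
`Σ_{ψ∈Ψ}|Σ_{n<N} a(n)ψ̄(n)n^{−w}|⁴ ≤ C₀⁺B⁺⁴·P²Σ_{1≤m<P²}τ₂(m)²/m` — square the polynomial
(`sq_dirPoly_eq`), pass from `ψ̄` to `ψ` by complex conjugation, apply the large sieve (`h33`,
Lemma 3.3 (ii)), and `|a′⋆a′| ≤ B²τ₂` (in the manuscript `N = ⌈PT⁻²⌉` for (7.5) and `N ≈ 2P₄` for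
the twin step (14.3)). [cite: Zhang2022LandauSiegel, §7 p.35, tex L1904–L1907; §14 (14.3) p.76] -/
theorem finsum_norm_dirPolyBar_pow_four_le {C₀ : ℝ}
    (h33 : ∀ (D : ℕ) (s : ℂ) (c : ℕ → ℂ),
      ∑ᶠ x : Skeleton.Chr D, ‖∑ n ∈ Finset.Icc 1 ⌊Skeleton.bigP D ^ 2⌋₊,
          c n * x.ψ (n : ZMod x.p) * (n : ℂ) ^ (-s)‖ ^ 2 ≤
        C₀ * Skeleton.bigP D ^ 2 *
          ∑ n ∈ Finset.Icc 1 ⌊Skeleton.bigP D ^ 2⌋₊, ‖c n‖ ^ 2 * (n : ℝ) ^ (-2 * s.re))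
    (N : ℕ) (hN : (((N - 1) * (N - 1) : ℕ) : ℝ) < Skeleton.bigP D ^ 2)
    {B : ℝ} {a₂ : ℕ → ℂ} (ha : ∀ n, ‖a₂ n‖ ≤ B) {w : ℂ} (hw : w.re = 1 / 2) :
    ∑ᶠ x : Skeleton.Chr D,
        ‖∑ n ∈ Finset.range N, a₂ n * x.ψ⁻¹ (n : ZMod x.p) * (n : ℂ) ^ (-w)‖ ^ 4 ≤
      max C₀ 0 * (max B 0) ^ 4 * (Skeleton.bigP D ^ 2 *
        ∑ m ∈ Finset.Ico 1 ⌈Skeleton.bigP D ^ 2⌉₊, tau 2 m ^ 2 / (m : ℝ)) := by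
  classical
  set P := Skeleton.bigP D with hPdef
  set Cf : ℕ → ℂ := seqConv (fun n => if n < N then a₂ n else 0)
    (fun n => if n < N then a₂ n else 0) with hCf
  have hsq_lt : (((N - 1) * (N - 1) : ℕ) : ℝ) < P ^ 2 := hN
  have hK : (N - 1) * (N - 1) ≤ ⌊P ^ 2⌋₊ := Nat.le_floor hsq_lt.le
  -- the square
  have hsq : ∀ x : Skeleton.Chr D,
      (∑ n ∈ Finset.range N, a₂ n * x.ψ⁻¹ (n : ZMod x.p) * (n : ℂ) ^ (-w)) ^ 2 =
      ∑ k ∈ Finset.Icc 1 ⌊P ^ 2⌋₊, Cf k * x.ψ⁻¹ (k : ZMod x.p) * (k : ℂ) ^ (-w) := fun x =>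
    sq_dirPoly_eq N ⌊P ^ 2⌋₊ hK a₂ (fun n => x.ψ⁻¹ (n : ZMod x.p))
      (by rw [Nat.cast_zero, MulChar.map_zero]) (fun m n => by rw [Nat.cast_mul, map_mul]) w
  -- `ψ̄`-sums are conjugates of `ψ`-sums
  have hconj : ∀ x : Skeleton.Chr D,
      ∑ k ∈ Finset.Icc 1 ⌊P ^ 2⌋₊, Cf k * x.ψ⁻¹ (k : ZMod x.p) * (k : ℂ) ^ (-w) =
        conj (∑ k ∈ Finset.Icc 1 ⌊P ^ 2⌋₊,
          conj (Cf k) * x.ψ (k : ZMod x.p) * (k : ℂ) ^ (-conj w)) := fun x => by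
    rw [map_sum]
    refine Finset.sum_congr rfl fun k _ => ?_
    rw [map_mul, map_mul, Complex.conj_conj]
    have h1 : conj (x.ψ (k : ZMod x.p)) = x.ψ⁻¹ (k : ZMod x.p) := by
      rw [starRingEnd_apply, MulChar.star_apply']
    have h2 : conj ((k : ℂ) ^ (-conj w)) = (k : ℂ) ^ (-w) := by
      have h := Complex.conj_cpow (k : ℂ) (-w)
        (by rw [Complex.natCast_arg]; exact Real.pi_ne_zero.symm)
      rw [Complex.conj_natCast, map_neg] at h
      exact h.symm
    rw [h1, h2]
  have h := h33 D (conj w) (fun k => conj (Cf k))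
  have hL : (fun x : Skeleton.Chr D =>
      ‖∑ n ∈ Finset.range N, a₂ n * x.ψ⁻¹ (n : ZMod x.p) * (n : ℂ) ^ (-w)‖ ^ 4) =
      fun x => ‖∑ k ∈ Finset.Icc 1 ⌊P ^ 2⌋₊,
        conj (Cf k) * x.ψ (k : ZMod x.p) * (k : ℂ) ^ (-conj w)‖ ^ 2 := by
    funext x
    rw [show (4 : ℕ) = 2 * 2 from rfl, pow_mul, ← norm_pow, hsq x, hconj x, Complex.norm_conj]
  -- the coefficient side
  have hsub := Ico_subset_Icc_floor (P ^ 2)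
  have hB0 : 0 ≤ max B 0 := le_max_right _ _
  have ha' : ∀ n, n ≠ 0 → ‖(fun n => if n < N then a₂ n else 0) n‖ ≤ max B 0 :=
    fun n _ => norm_truncSeq_le ha n
  have hcoef : ∑ k ∈ Finset.Icc 1 ⌊P ^ 2⌋₊, ‖conj (Cf k)‖ ^ 2 * (k : ℝ) ^ (-2 * (conj w).re) ≤
      (max B 0) ^ 4 * ∑ m ∈ Finset.Ico 1 ⌈P ^ 2⌉₊, tau 2 m ^ 2 / (m : ℝ) := by
    rw [Complex.conj_re, hw, show (-2 * (1 / 2 : ℝ)) = -1 by norm_num]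
    rw [← Finset.sum_subset hsub (fun k hk hk' => by
      have hge : P ^ 2 ≤ (k : ℝ) := not_lt.1 (not_lt_of_mem_sdiff hk hk')
      have hlt : (N - 1) * (N - 1) < k := by exact_mod_cast hsq_lt.trans_le hge
      simp only [hCf, seqConv_truncSeq_eq_zero a₂ hlt, _root_.map_zero, norm_zero]; simp),
      Finset.mul_sum]
    refine Finset.sum_le_sum fun k _ => ?_
    rw [Complex.norm_conj, Real.rpow_neg_one]
    have hk : ‖Cf k‖ ≤ max B 0 * max B 0 * tau 2 k := norm_seqConv_le_tau_two hB0 ha' ha' k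
    have hk2 := pow_le_pow_left₀ (norm_nonneg _) hk 2
    calc ‖Cf k‖ ^ 2 * (k : ℝ)⁻¹ ≤ (max B 0 * max B 0 * tau 2 k) ^ 2 * (k : ℝ)⁻¹ :=
          mul_le_mul_of_nonneg_right hk2 (by positivity)
      _ = (max B 0) ^ 4 * (tau 2 k ^ 2 / k) := by ring
  have hS : 0 ≤ ∑ k ∈ Finset.Icc 1 ⌊P ^ 2⌋₊, ‖conj (Cf k)‖ ^ 2 * (k : ℝ) ^ (-2 * (conj w).re) :=
    Finset.sum_nonneg fun n _ => by positivity
  rw [hL]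
  calc ∑ᶠ x : Skeleton.Chr D, ‖∑ k ∈ Finset.Icc 1 ⌊P ^ 2⌋₊,
        conj (Cf k) * x.ψ (k : ZMod x.p) * (k : ℂ) ^ (-conj w)‖ ^ 2
      ≤ C₀ * P ^ 2 * ∑ k ∈ Finset.Icc 1 ⌊P ^ 2⌋₊, ‖conj (Cf k)‖ ^ 2 * (k : ℝ) ^ (-2 * (conj w).re) := h
    _ ≤ max C₀ 0 * P ^ 2 *
          ∑ k ∈ Finset.Icc 1 ⌊P ^ 2⌋₊, ‖conj (Cf k)‖ ^ 2 * (k : ℝ) ^ (-2 * (conj w).re) :=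
        mul_le_mul_of_nonneg_right (mul_le_mul_of_nonneg_right (le_max_left _ _) (sq_nonneg _)) hS
    _ ≤ max C₀ 0 * P ^ 2 * ((max B 0) ^ 4 * ∑ m ∈ Finset.Ico 1 ⌈P ^ 2⌉₊, tau 2 m ^ 2 / (m : ℝ)) :=
        mul_le_mul_of_nonneg_left hcoef (by positivity)
    _ = _ := by ring


/-- **Factor (ii) of the Cauchy chain**, to the fourth power: for `|a₂| ≤ B`, `Re w = 1/2` and
`T > 1` (i.e. `D ≥ 2`), `Σ_{ψ∈Ψ}|A(𝐚₂;w,ψ̄)|⁴ ≤ C₀⁺B⁺⁴·P²Σ_{1≤m<P²}τ₂(m)²/m` — the generic fourth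
moment at the length `N = ⌈PT⁻²⌉` of (7.2), `(N−1)² ≤ P²T⁻⁴ < P²`.
[cite: Zhang2022LandauSiegel, §7 p.35, tex L1904–L1907] -/
theorem finsum_norm_ApolyBar_pow_four_le {C₀ : ℝ}
    (h33 : ∀ (D : ℕ) (s : ℂ) (c : ℕ → ℂ),
      ∑ᶠ x : Skeleton.Chr D, ‖∑ n ∈ Finset.Icc 1 ⌊Skeleton.bigP D ^ 2⌋₊,
          c n * x.ψ (n : ZMod x.p) * (n : ℂ) ^ (-s)‖ ^ 2 ≤
        C₀ * Skeleton.bigP D ^ 2 *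
          ∑ n ∈ Finset.Icc 1 ⌊Skeleton.bigP D ^ 2⌋₊, ‖c n‖ ^ 2 * (n : ℝ) ^ (-2 * s.re))
    (hT : 1 < Skeleton.bigT D) {B : ℝ} {a₂ : ℕ → ℂ} (ha : ∀ n, ‖a₂ n‖ ≤ B) {w : ℂ}
    (hw : w.re = 1 / 2) :
    ∑ᶠ x : Skeleton.Chr D, ‖Skeleton.ApolyBar x a₂ w‖ ^ 4 ≤
      max C₀ 0 * (max B 0) ^ 4 * (Skeleton.bigP D ^ 2 *
        ∑ m ∈ Finset.Ico 1 ⌈Skeleton.bigP D ^ 2⌉₊, tau 2 m ^ 2 / (m : ℝ)) := by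
  set N := Skeleton.Nsupp D with hNdef
  have hP : 0 < Skeleton.bigP D := Real.exp_pos _
  have hN1 : ((N - 1 : ℕ) : ℝ) ≤ Skeleton.bigP D / Skeleton.bigT D ^ 2 :=
    cast_ceil_sub_one_le (by positivity)
  have hPT : Skeleton.bigP D / Skeleton.bigT D ^ 2 < Skeleton.bigP D :=
    div_lt_self hP (one_lt_pow₀ hT two_ne_zero)
  have hsq_lt : (((N - 1) * (N - 1) : ℕ) : ℝ) < Skeleton.bigP D ^ 2 := by
    have h0 : (0 : ℝ) ≤ ((N - 1 : ℕ) : ℝ) := Nat.cast_nonneg _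
    have h1 : ((N - 1 : ℕ) : ℝ) < Skeleton.bigP D := lt_of_le_of_lt hN1 hPT
    push_cast
    nlinarith
  exact finsum_norm_dirPolyBar_pow_four_le h33 N hsq_lt ha hw

end Factors

/-! ### The printed divisor-function counts at `x = P²` -/

/-- **The printed counts** `Σ_{m<P²}τ₅(m)²/m ≪ (log P²)²⁵`, `Σ_{m<P²}τ₂(m)²/m ≪ (log P²)⁴` at
`log P² = 2𝓛⁹`: for `𝓛 ≥ 1`, `Σ_{1≤m<P²} τ_j(m)²/m ≤ M_j · (2𝓛⁹)^{j²}` with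
`M_j = majorantConst (j²) (2j)` (tree `MeanSquareMajorant.sum_tau_sq_div_le`).
[cite: Zhang2022LandauSiegel, §7 p.35, tex L1907] -/
theorem sum_tau_sq_div_Ico_le (j : ℕ) {D : ℕ} (hD : 1 ≤ Skeleton.ell D) :
    ∑ m ∈ Finset.Ico 1 ⌈Skeleton.bigP D ^ 2⌉₊, tau j m ^ 2 / (m : ℝ) ≤
      majorantConst (j ^ 2) (2 * j) * (2 * Skeleton.ell D ^ 9) ^ (j ^ 2) := by
  set L := Skeleton.ell D with hLdef
  have hP2 : Skeleton.bigP D ^ 2 = Real.exp (2 * L ^ 9) := by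
    rw [show Skeleton.bigP D = Real.exp (L ^ 9) from rfl, ← Real.exp_nat_mul]; norm_num
  set X := ⌈Skeleton.bigP D ^ 2⌉₊ - 1 with hXdef
  have hL9 : 1 ≤ L ^ 9 := one_le_pow₀ hD
  have h3 : (3 : ℝ) ≤ Skeleton.bigP D ^ 2 := by
    rw [hP2]
    have h := Real.add_one_le_exp (2 * L ^ 9)
    linarith
  have hX2 : 2 ≤ X := by
    have h : (3 : ℝ) ≤ (⌈Skeleton.bigP D ^ 2⌉₊ : ℝ) := h3.trans (Nat.le_ceil _)
    have h' : 3 ≤ ⌈Skeleton.bigP D ^ 2⌉₊ := by exact_mod_cast h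
    omega
  have hXle : (X : ℝ) ≤ Skeleton.bigP D ^ 2 := cast_ceil_sub_one_le (by positivity)
  have hX1 : (1 : ℝ) ≤ X := by exact_mod_cast (by omega : 1 ≤ X)
  have hlog : Real.log X ≤ 2 * L ^ 9 := by
    calc Real.log X ≤ Real.log (Skeleton.bigP D ^ 2) := Real.log_le_log (by linarith) hXle
      _ = 2 * L ^ 9 := by rw [hP2, Real.log_exp]
  rw [Ico_one_ceil_eq]
  calc ∑ m ∈ Finset.Icc 1 X, tau j m ^ 2 / (m : ℝ)
      ≤ majorantConst (j ^ 2) (2 * j) * Real.log X ^ (j ^ 2) := sum_tau_sq_div_le j hX2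
    _ ≤ majorantConst (j ^ 2) (2 * j) * (2 * L ^ 9) ^ (j ^ 2) :=
        mul_le_mul_of_nonneg_left (pow_le_pow_left₀ (Real.log_nonneg hX1) hlog _)
          (majorantConst_pos _ _).le

/-! ### The exponent count -/

/-- **The exponent count of (7.5), on opaque reals.** If
`X ≤ C (P²S₅)^{1/2}(P²S₂)^{1/4}n₂^{1/4}` with `S₅ ≤ M₅(2L⁹)²⁵`, `S₂ ≤ M₂(2L⁹)⁴`,
`n₂ ≤ C₂₁ F L⁻⁷³⁹` (Prop. 2.1) and `|F − P²L⁻⁷⁷| ≤ 3L⁻⁶⁸·P²L⁻⁷⁷` ((2.9)), then `X ≤ εF` as soon as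
`L ≥ 6` and `L ≥ 8K₁/ε⁴`, `K₁ = |C|⁴M₅²M₂|C₂₁|2⁵⁴` (fourth powers: `L^{450+36−739} = L⁻²⁵³` against
`L⁻²³¹`, i.e. the printed `≪ P²𝓛^{−82.5} = o(P²𝓛⁻⁷⁷)`).
[cite: Zhang2022LandauSiegel, §7 (7.5) p.35, tex L1903–L1910] -/
theorem le_eps_mul_of_bounds {X C C₂₁ M₅ M₂ P S5 S2 n2 F L ε : ℝ} (hε : 0 < ε) (hP : 0 < P)
    (hS5 : 0 ≤ S5) (hS2 : 0 ≤ S2) (hn2 : 0 ≤ n2) (hM2 : 0 ≤ M₂)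
    (hX : X ≤ C * (P ^ 2 * S5) ^ (1 / 2 : ℝ) * (P ^ 2 * S2) ^ (1 / 4 : ℝ) * n2 ^ (1 / 4 : ℝ))
    (hS5le : S5 ≤ M₅ * (2 * L ^ 9) ^ (5 ^ 2)) (hS2le : S2 ≤ M₂ * (2 * L ^ 9) ^ (2 ^ 2))
    (hn2le : n2 ≤ C₂₁ * F * (L ^ 739)⁻¹)
    (hfr : |F - P ^ 2 * (L ^ 77)⁻¹| ≤ 3 * (L ^ 68)⁻¹ * (P ^ 2 * (L ^ 77)⁻¹))
    (hL6 : 6 ≤ L) (hLK : 8 * (|C| ^ 4 * M₅ ^ 2 * M₂ * |C₂₁| * 2 ^ 54) / ε ^ 4 ≤ L) :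
    X ≤ ε * F := by
  have hL1 : 1 ≤ L := by linarith
  have hL0 : 0 < L := by linarith
  have hK₁ : 0 ≤ |C| ^ 4 * M₅ ^ 2 * M₂ * |C₂₁| * 2 ^ 54 := by positivity
  -- (2.9): `Q/2 ≤ F ≤ 2Q`, `Q = P²L⁻⁷⁷`
  have hQ : 0 ≤ P ^ 2 * (L ^ 77)⁻¹ := by positivity
  have h3L : 3 * (L ^ 68)⁻¹ ≤ 1 / 2 := by
    have h68 : (6 : ℝ) ≤ L ^ 68 := le_trans hL6 (le_self_pow₀ hL1 (by norm_num))
    rw [show 3 * (L ^ 68)⁻¹ = 3 / L ^ 68 from by ring,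
      div_le_div_iff₀ (by positivity) (by norm_num)]
    linarith
  have hfr' : |F - P ^ 2 * (L ^ 77)⁻¹| ≤ 1 / 2 * (P ^ 2 * (L ^ 77)⁻¹) :=
    hfr.trans (mul_le_mul_of_nonneg_right h3L hQ)
  have hFlo : P ^ 2 * (L ^ 77)⁻¹ / 2 ≤ F := by
    have := (abs_sub_le_iff.1 hfr').2; linarith
  have hF : 0 ≤ F := le_trans (by positivity) hFlo
  have hn2le' : n2 ≤ |C₂₁| * F * (L ^ 739)⁻¹ :=
    hn2le.trans (mul_le_mul_of_nonneg_right
      (mul_le_mul_of_nonneg_right (le_abs_self _) hF) (by positivity))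
  -- `X ≤ R`, `R = |C|·(…)`
  have hX5 : 0 ≤ P ^ 2 * S5 := by positivity
  have hX2 : 0 ≤ P ^ 2 * S2 := by positivity
  have hprod : 0 ≤ (P ^ 2 * S5) ^ (1 / 2 : ℝ) * (P ^ 2 * S2) ^ (1 / 4 : ℝ) * n2 ^ (1 / 4 : ℝ) := by
    positivity
  have hXR : X ≤ |C| * ((P ^ 2 * S5) ^ (1 / 2 : ℝ) * (P ^ 2 * S2) ^ (1 / 4 : ℝ) * n2 ^ (1 / 4 : ℝ)) := by
    refine hX.trans ?_
    have hC := mul_le_mul_of_nonneg_right (le_abs_self C) hprod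
    calc C * (P ^ 2 * S5) ^ (1 / 2 : ℝ) * (P ^ 2 * S2) ^ (1 / 4 : ℝ) * n2 ^ (1 / 4 : ℝ)
        = C * ((P ^ 2 * S5) ^ (1 / 2 : ℝ) * (P ^ 2 * S2) ^ (1 / 4 : ℝ) * n2 ^ (1 / 4 : ℝ)) := by
          ring
      _ ≤ _ := hC
  have hR0 : 0 ≤ |C| * ((P ^ 2 * S5) ^ (1 / 2 : ℝ) * (P ^ 2 * S2) ^ (1 / 4 : ℝ) * n2 ^ (1 / 4 : ℝ)) :=
    mul_nonneg (abs_nonneg C) hprod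
  -- fourth powers
  have ha4 : ((P ^ 2 * S5) ^ (1 / 2 : ℝ)) ^ 4 = (P ^ 2 * S5) ^ 2 := by
    rw [← Real.rpow_natCast, ← Real.rpow_mul hX5,
      show ((1 : ℝ) / 2 * ((4 : ℕ) : ℝ)) = 2 by norm_num, Real.rpow_two]
  have hb4 : ((P ^ 2 * S2) ^ (1 / 4 : ℝ)) ^ 4 = P ^ 2 * S2 := by
    rw [← Real.rpow_natCast, ← Real.rpow_mul hX2,
      show ((1 : ℝ) / 4 * ((4 : ℕ) : ℝ)) = 1 by norm_num, Real.rpow_one]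
  have hc4 : (n2 ^ (1 / 4 : ℝ)) ^ 4 = n2 := by
    rw [← Real.rpow_natCast, ← Real.rpow_mul hn2,
      show ((1 : ℝ) / 4 * ((4 : ℕ) : ℝ)) = 1 by norm_num, Real.rpow_one]
  have hR4 : (|C| * ((P ^ 2 * S5) ^ (1 / 2 : ℝ) * (P ^ 2 * S2) ^ (1 / 4 : ℝ) * n2 ^ (1 / 4 : ℝ))) ^ 4
      = |C| ^ 4 * (P ^ 2 * S5) ^ 2 * (P ^ 2 * S2) * n2 := by
    calc (|C| * ((P ^ 2 * S5) ^ (1 / 2 : ℝ) * (P ^ 2 * S2) ^ (1 / 4 : ℝ) * n2 ^ (1 / 4 : ℝ))) ^ 4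
        = |C| ^ 4 * ((P ^ 2 * S5) ^ (1 / 2 : ℝ)) ^ 4 * ((P ^ 2 * S2) ^ (1 / 4 : ℝ)) ^ 4 *
            (n2 ^ (1 / 4 : ℝ)) ^ 4 := by ring
      _ = |C| ^ 4 * (P ^ 2 * S5) ^ 2 * (P ^ 2 * S2) * n2 := by rw [ha4, hb4, hc4]
  have hR4le : |C| ^ 4 * (P ^ 2 * S5) ^ 2 * (P ^ 2 * S2) * n2 ≤
      (|C| ^ 4 * M₅ ^ 2 * M₂ * |C₂₁| * 2 ^ 54) * (P ^ 6 * F) / L ^ 253 := by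
    have h5 : (P ^ 2 * S5) ^ 2 ≤ (P ^ 2 * (M₅ * (2 * L ^ 9) ^ (5 ^ 2))) ^ 2 :=
      pow_le_pow_left₀ hX5 (mul_le_mul_of_nonneg_left hS5le (sq_nonneg _)) 2
    have h2 : P ^ 2 * S2 ≤ P ^ 2 * (M₂ * (2 * L ^ 9) ^ (2 ^ 2)) :=
      mul_le_mul_of_nonneg_left hS2le (sq_nonneg _)
    calc |C| ^ 4 * (P ^ 2 * S5) ^ 2 * (P ^ 2 * S2) * n2
        ≤ |C| ^ 4 * (P ^ 2 * (M₅ * (2 * L ^ 9) ^ (5 ^ 2))) ^ 2 *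
            (P ^ 2 * (M₂ * (2 * L ^ 9) ^ (2 ^ 2))) * (|C₂₁| * F * (L ^ 739)⁻¹) := by
          gcongr
    _ = (|C| ^ 4 * M₅ ^ 2 * M₂ * |C₂₁| * 2 ^ 54) * (P ^ 6 * F) * (L ^ 486 / L ^ 739) := by
          ring
    _ = (|C| ^ 4 * M₅ ^ 2 * M₂ * |C₂₁| * 2 ^ 54) * (P ^ 6 * F) / L ^ 253 := by
          have hL739 : L ^ 739 = L ^ 486 * L ^ 253 := by rw [← pow_add]
          rw [hL739, div_mul_cancel_left₀ (pow_ne_zero _ hL0.ne')]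
          ring
  -- `(εF)⁴ ≥ ε⁴ F (Q/2)³`
  have hε4 : ε ^ 4 * (P ^ 6 * F) / (8 * L ^ 231) ≤ (ε * F) ^ 4 := by
    have h1 : (P ^ 2 * (L ^ 77)⁻¹ / 2) ^ 3 ≤ F ^ 3 := pow_le_pow_left₀ (by positivity) hFlo 3
    have e : ε ^ 4 * (P ^ 6 * F) / (8 * L ^ 231) = ε ^ 4 * F * (P ^ 2 * (L ^ 77)⁻¹ / 2) ^ 3 := by
      field_simp
      ring
    rw [e]
    calc ε ^ 4 * F * (P ^ 2 * (L ^ 77)⁻¹ / 2) ^ 3 ≤ ε ^ 4 * F * F ^ 3 :=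
          mul_le_mul_of_nonneg_left h1 (by positivity)
      _ = (ε * F) ^ 4 := by ring
  -- the comparison `K₁ L⁻²⁵³ ≤ ε⁴ L⁻²³¹/8`
  have hkey : (|C| ^ 4 * M₅ ^ 2 * M₂ * |C₂₁| * 2 ^ 54) * (P ^ 6 * F) / L ^ 253 ≤
      ε ^ 4 * (P ^ 6 * F) / (8 * L ^ 231) := by
    have hcmp : (|C| ^ 4 * M₅ ^ 2 * M₂ * |C₂₁| * 2 ^ 54) / L ^ 253 ≤ ε ^ 4 / (8 * L ^ 231) := by
      rw [div_le_div_iff₀ (by positivity) (by positivity)]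
      have h22 : 8 * (|C| ^ 4 * M₅ ^ 2 * M₂ * |C₂₁| * 2 ^ 54) ≤ ε ^ 4 * L ^ 22 := by
        have h := (div_le_iff₀ (by positivity : (0 : ℝ) < ε ^ 4)).1 hLK
        calc 8 * (|C| ^ 4 * M₅ ^ 2 * M₂ * |C₂₁| * 2 ^ 54) ≤ L * ε ^ 4 := h
          _ ≤ L ^ 22 * ε ^ 4 :=
              mul_le_mul_of_nonneg_right (le_self_pow₀ hL1 (by norm_num)) (by positivity)
          _ = ε ^ 4 * L ^ 22 := by ring
      calc (|C| ^ 4 * M₅ ^ 2 * M₂ * |C₂₁| * 2 ^ 54) * (8 * L ^ 231)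
          = 8 * (|C| ^ 4 * M₅ ^ 2 * M₂ * |C₂₁| * 2 ^ 54) * L ^ 231 := by ring
        _ ≤ ε ^ 4 * L ^ 22 * L ^ 231 := mul_le_mul_of_nonneg_right h22 (by positivity)
        _ = ε ^ 4 * L ^ 253 := by rw [mul_assoc, ← pow_add]
    have hPF : 0 ≤ P ^ 6 * F := by positivity
    calc (|C| ^ 4 * M₅ ^ 2 * M₂ * |C₂₁| * 2 ^ 54) * (P ^ 6 * F) / L ^ 253
        = (|C| ^ 4 * M₅ ^ 2 * M₂ * |C₂₁| * 2 ^ 54) / L ^ 253 * (P ^ 6 * F) := by ring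
      _ ≤ ε ^ 4 / (8 * L ^ 231) * (P ^ 6 * F) := mul_le_mul_of_nonneg_right hcmp hPF
      _ = ε ^ 4 * (P ^ 6 * F) / (8 * L ^ 231) := by ring
  have h4 : (|C| * ((P ^ 2 * S5) ^ (1 / 2 : ℝ) * (P ^ 2 * S2) ^ (1 / 4 : ℝ) * n2 ^ (1 / 4 : ℝ))) ^ 4
      ≤ (ε * F) ^ 4 := by
    rw [hR4]
    exact hR4le.trans (hkey.trans hε4)
  have hεF : 0 ≤ ε * F := mul_nonneg hε.le hF
  exact hXR.trans ((pow_le_pow_iff_left₀ hR0 hεF four_ne_zero).1 h4)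

end Literature.NumberTheory.LFunctions.Zhang2022.Section7Eq75
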